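import Mathlib
import HarnessLib
import Summits.Ventures.LatticeQCDFlow.Exactness.NCMCGeneralSpaceGammaMethodConsistency

/-!
# A CERTIFIED window for the Γ-method: with the Doeblin certificate `(m, ε)` in hand, the window `W_N = m(⌈log N/(2e)⌉ + 1) − 1` makes the mean-square error of scorer A's variance statistic `O(log³ N / N)` from EVERY initial law, with explicit constants

HONEST FRAMING: exact (Metropolis-corrected) sampling algorithms for lattice gauge theory;
figures of merit are autocorrelation/cost numbers at stated couplings and volumes; no
continuum-physics claim.

Venture `LatticeQCDFlow` (cell pub-lqcd), topic `Exactness`; FANOUT row 13 (`eng-snf`, GEN-22).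
NEW WORK of the cell, not a published result; no definition is introduced; nothing is cited as a
fact.  GEN-20's `chain_mse_gammaWindow_le_of_nHit` bounds the mean-square error of the Γ-method
statistic `Γ̂_N(0) + 2 Σ_{t<W} Γ̂_N(t+1)` about the Green–Kubo variance `σ²_f` by
`(3 + 12W²) K₀/N + 12288 C⁴ W³/N + 768 C⁴ (m/e)² (1 − e)^{2⌊(W+1)/m⌋}` for every window `W` with
`2W ≤ N`, and its consistency corollary asks for deterministic windows with `W_N → ∞`, `W_N³/N → 0`
(GEN-20 NOT-CLAIMED: "the optimal window or the sharp rate").  When the chain comes WITH A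
CERTIFICATE `(m, ε)` — as every exactly-certified sampler of the venture does (rows 8/9's heat-bath
and Metropolis sweeps, the exact flow sampler, GEN-18's NCMC two-step certificate) — the truncation
term can be driven below `1/N` by a window logarithmic in `N`, and this file records the resulting
explicit `O(log³ N / N)` rate; nothing data-dependent is involved.

## Content (`κ` Markov, `π` invariant, `(nHit κ m)(x, ·) ≥ ε ν` setwise, `0 < ε ≤ 1`, `0 < m`;
## `|f| ≤ C` measurable; `e = ε.toReal`, `K₀ = C⁴ (2112 + 4224 m/e + 512 (m/e)²)`; `μ₀` ANY initial law)

* **`chain_mse_gammaWindow_le_of_truncation_le`** — if the window satisfies `2W ≤ N`, `0 < N` and the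
  truncation condition `(1 − e)^{2⌊(W+1)/m⌋} ≤ 1/N`, then
  `MSE ≤ (3 K₀ + 768 C⁴ (m/e)² + (12 K₀ + 12288 C⁴) W³) / N`.
* **`truncation_le_inv_of_certifiedWindow`** — with
  `W = m (⌈log N/(2e)⌉₊ + 1) − 1`: `(1 − e)^{2⌊(W+1)/m⌋} ≤ 1/N` (`N ≥ 1`).
* `certifiedWindow_le` — `W ≤ m (log N/(2e) + 2)`.
* **`chain_mse_gammaWindow_certifiedWindow_le`** — THE RATE: for `N ≥ 1` with `2W ≤ N`,
  `MSE ≤ (3 K₀ + 768 C⁴ (m/e)² + (12 K₀ + 12288 C⁴) m³ (log N/(2e) + 2)³) / N`.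

Reading (value-free): the certificate buys a window rule with a PROVED mean-square error
`O((m/e)³ log³ N / N)` for the printed error bar's variance statistic — the price of certification
over Wolff's automatic window is a logarithmic factor, not a power.  NOT CLAIMED: optimality of the
rule or of any constant; data-dependent windows (GEN-20 `…DataWindow` covers clipped rules);
anything numerical.
-/

namespace Summit.Ventures.LatticeQCDFlow.Exactness.GeneralNCMC

open MeasureTheory ProbabilityTheory Set Filter Finset
open scoped ENNReal Topology

/-! ## §1 The certified window and its truncation bound -/

/-- **The truncation term under the certified window**: for `0 ≤ e ≤ 1`, `0 < e`, `0 < m`, `1 ≤ N` and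
`W = m (⌈log N/(2e)⌉₊ + 1) − 1`: `(1 − e)^{2 ((W+1)/m)} ≤ 1/N`. -/
theorem truncation_le_inv_of_certifiedWindow {e : ℝ} (he0 : 0 < e) (he1 : e ≤ 1) {m : ℕ} (hm : 0 < m)
    {N : ℕ} (hN : 1 ≤ N) :
    (1 - e) ^ (2 * ((m * (⌈Real.log N / (2 * e)⌉₊ + 1) - 1 + 1) / m)) ≤ 1 / (N : ℝ) := by
  set k := ⌈Real.log N / (2 * e)⌉₊ with hk
  have hmk : 1 ≤ m * (k + 1) := Nat.one_le_iff_ne_zero.2 (Nat.mul_ne_zero hm.ne' (Nat.succ_ne_zero k))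
  have hdiv : (m * (k + 1) - 1 + 1) / m = k + 1 := by
    rw [Nat.sub_add_cancel hmk, Nat.mul_div_cancel_left _ hm]
  rw [hdiv]
  have hN' : (0 : ℝ) < N := by exact_mod_cast hN
  have h1e : 0 ≤ 1 - e := by linarith
  -- `(1 − e)^{2(k+1)} ≤ (1 − e)^{2k} ≤ exp(−e)^{2k} = exp(−2ek) ≤ exp(−log N) = 1/N`
  have hk' : Real.log N / (2 * e) ≤ k := by rw [hk]; exact Nat.le_ceil _
  have hlog : Real.log N ≤ 2 * e * k := by
    rwa [div_le_iff₀ (by positivity), mul_comm] at hk'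
  calc (1 - e) ^ (2 * (k + 1)) ≤ (1 - e) ^ (2 * k) :=
        pow_le_pow_of_le_one h1e (by linarith) (by omega)
    _ ≤ Real.exp (-e) ^ (2 * k) := pow_le_pow_left₀ h1e (Real.one_sub_le_exp_neg e) _
    _ = Real.exp (-(2 * e * k)) := by rw [← Real.exp_nat_mul]; congr 1; push_cast; ring
    _ ≤ Real.exp (-Real.log N) := Real.exp_le_exp.2 (by linarith)
    _ = 1 / (N : ℝ) := by rw [Real.exp_neg, Real.exp_log hN', one_div]

/-- **The certified window is logarithmic**: `W = m (⌈log N/(2e)⌉₊ + 1) − 1 ≤ m (log N/(2e) + 2)` for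
`N ≥ 1`, `e > 0`. -/
theorem certifiedWindow_le {e : ℝ} (he0 : 0 < e) (m : ℕ) {N : ℕ} (hN : 1 ≤ N) :
    ((m * (⌈Real.log N / (2 * e)⌉₊ + 1) - 1 : ℕ) : ℝ) ≤ m * (Real.log N / (2 * e) + 2) := by
  have hN' : (1 : ℝ) ≤ N := by exact_mod_cast hN
  have hlog0 : 0 ≤ Real.log N / (2 * e) := div_nonneg (Real.log_nonneg hN') (by positivity)
  have hceil : (⌈Real.log N / (2 * e)⌉₊ : ℝ) < Real.log N / (2 * e) + 1 := Nat.ceil_lt_add_one hlog0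
  have hsub : ((m * (⌈Real.log N / (2 * e)⌉₊ + 1) - 1 : ℕ) : ℝ) ≤ (m * (⌈Real.log N / (2 * e)⌉₊ + 1) : ℕ) := by
    exact_mod_cast Nat.sub_le _ _
  refine hsub.trans ?_
  push_cast
  have hm0 : (0 : ℝ) ≤ m := Nat.cast_nonneg m
  nlinarith [hceil, hm0]

/-! ## §2 The mean-square error under a truncation condition, and the rate -/

section Chain

variable {S : Type*} [MeasurableSpace S]
variable {κ : Kernel S S} [IsMarkovKernel κ] {ν : Measure S} [IsProbabilityMeasure ν] {ε : ℝ≥0∞}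
  {π : Measure S} [IsProbabilityMeasure π] {m : ℕ} (μ₀ : Measure S) [IsProbabilityMeasure μ₀]

/-- **MSE UNDER A TRUNCATION CONDITION.**  `κ` Markov, `π` invariant, `(nHit κ m)(x, ·) ≥ ε ν`
(`0 < ε ≤ 1`, `0 < m`), `|f| ≤ C` measurable; `2W ≤ N`, `0 < N`, and `(1 − e)^{2⌊(W+1)/m⌋} ≤ 1/N`.
Then, from every initial law,
`MSE ≤ (3 K₀ + 768 C⁴ (m/e)² + (12 K₀ + 12288 C⁴) W³) / N`, `K₀ = C⁴ (2112 + 4224 m/e + 512 (m/e)²)`. -/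
theorem chain_mse_gammaWindow_le_of_truncation_le
    (hmin : ∀ x {B : Set S}, MeasurableSet B → ε * ν B ≤ nHit κ m x B) (hε0 : 0 < ε) (hε1 : ε ≤ 1)
    (hm : 0 < m) (hπ : Kernel.Invariant κ π) {f : S → ℝ} (hf : Measurable f) {C : ℝ}
    (hC : ∀ x, |f x| ≤ C) {N W : ℕ} (hWN : 2 * W ≤ N) (hN : 0 < N)
    (htrunc : (1 - ε.toReal) ^ (2 * ((W + 1) / m)) ≤ 1 / (N : ℝ)) :
    ∫ x, (Scoring.gammaHat (fun i => f (x i)) N 0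
          + 2 * ∑ t ∈ range W, Scoring.gammaHat (fun i => f (x i)) N (t + 1)
        - (Scoring.autocov κ π (fun y => f y - ∫ z, f z ∂π) 0
          + 2 * ∑' t, Scoring.autocov κ π (fun y => f y - ∫ z, f z ∂π) (t + 1))) ^ 2
        ∂(Kernel.trajMeasure (X := fun _ : ℕ => S) μ₀
        (fun n : ℕ => κ.comap (fun h : (i : ↥(Finset.Iic n)) → S => h ⟨n, Finset.mem_Iic.2 le_rfl⟩)
          (measurable_pi_apply _)))
      ≤ (3 * (C ^ 4 * (2112 + 4224 * m / ε.toReal + 512 * (m / ε.toReal) ^ 2))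
          + 768 * C ^ 4 * (m / ε.toReal) ^ 2
          + (12 * (C ^ 4 * (2112 + 4224 * m / ε.toReal + 512 * (m / ε.toReal) ^ 2)) + 12288 * C ^ 4)
            * (W : ℝ) ^ 3) / N := by
  have hmse := chain_mse_gammaWindow_le_of_nHit μ₀ hmin hε0 hε1 hm hπ hf hC hWN hN
  refine hmse.trans ?_
  set K0 : ℝ := C ^ 4 * (2112 + 4224 * m / ε.toReal + 512 * (m / ε.toReal) ^ 2) with hK0
  have hN' : (0 : ℝ) < N := by exact_mod_cast hN
  have hεtop : ε ≠ ∞ := ne_top_of_le_ne_top ENNReal.one_ne_top hε1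
  have hεpos : 0 < ε.toReal := ENNReal.toReal_pos hε0.ne' hεtop
  have hC0 : 0 ≤ C := (abs_nonneg _).trans (hC (Classical.choice (nonempty_of_isProbabilityMeasure μ₀)))
  have hC4 : 0 ≤ C ^ 4 := by positivity
  have hK0nn : 0 ≤ K0 := by rw [hK0]; positivity
  have hW0 : (0 : ℝ) ≤ W := Nat.cast_nonneg W
  -- `W² ≤ W³` on the naturals (`W = 0` or `W ≥ 1`)
  have hW23 : (W : ℝ) ^ 2 ≤ (W : ℝ) ^ 3 := by
    rcases Nat.eq_zero_or_pos W with hW | hW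
    · subst hW; simp
    · have h1 : (1 : ℝ) ≤ W := by exact_mod_cast hW
      nlinarith [h1, sq_nonneg (W : ℝ)]
  -- the truncation term
  have hT : 768 * C ^ 4 * (m / ε.toReal) ^ 2 * (1 - ε.toReal) ^ (2 * ((W + 1) / m))
      ≤ 768 * C ^ 4 * (m / ε.toReal) ^ 2 / N := by
    rw [div_eq_mul_one_div]
    exact mul_le_mul_of_nonneg_left (htrunc.trans_eq (one_div _)) (by positivity)
  have h1 : (3 + 12 * (W : ℝ) ^ 2) * K0 / N ≤ (3 * K0 + 12 * K0 * (W : ℝ) ^ 3) / N := by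
    refine div_le_div_of_nonneg_right ?_ hN'.le
    nlinarith [hW23, hK0nn]
  calc (3 + 12 * (W : ℝ) ^ 2) * K0 / N + 12288 * C ^ 4 * (W : ℝ) ^ 3 / N
        + 768 * C ^ 4 * (m / ε.toReal) ^ 2 * (1 - ε.toReal) ^ (2 * ((W + 1) / m))
      ≤ (3 * K0 + 12 * K0 * (W : ℝ) ^ 3) / N + 12288 * C ^ 4 * (W : ℝ) ^ 3 / N
        + 768 * C ^ 4 * (m / ε.toReal) ^ 2 / N := add_le_add (add_le_add h1 le_rfl) hT
    _ = (3 * K0 + 768 * C ^ 4 * (m / ε.toReal) ^ 2 + (12 * K0 + 12288 * C ^ 4) * (W : ℝ) ^ 3) / N := by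
        field_simp
        ring

/-- **THE RATE UNDER THE CERTIFIED WINDOW, FROM EVERY INITIAL LAW.**  `κ` Markov, `π` invariant,
`(nHit κ m)(x, ·) ≥ ε ν` (`0 < ε ≤ 1`, `0 < m`), `|f| ≤ C` measurable, `e = ε.toReal`; for `N ≥ 1` and
the window `W = m (⌈log N/(2e)⌉₊ + 1) − 1` with `2W ≤ N`:
`E_{μ₀}[(Γ̂_N(0) + 2 Σ_{t<W} Γ̂_N(t+1) − σ²_f)²]
   ≤ (3 K₀ + 768 C⁴ (m/e)² + (12 K₀ + 12288 C⁴) m³ (log N/(2e) + 2)³) / N`. -/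
theorem chain_mse_gammaWindow_certifiedWindow_le
    (hmin : ∀ x {B : Set S}, MeasurableSet B → ε * ν B ≤ nHit κ m x B) (hε0 : 0 < ε) (hε1 : ε ≤ 1)
    (hm : 0 < m) (hπ : Kernel.Invariant κ π) {f : S → ℝ} (hf : Measurable f) {C : ℝ}
    (hC : ∀ x, |f x| ≤ C) {N : ℕ} (hN : 1 ≤ N)
    (hWN : 2 * (m * (⌈Real.log N / (2 * ε.toReal)⌉₊ + 1) - 1) ≤ N) :
    ∫ x, (Scoring.gammaHat (fun i => f (x i)) N 0
          + 2 * ∑ t ∈ range (m * (⌈Real.log N / (2 * ε.toReal)⌉₊ + 1) - 1),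
            Scoring.gammaHat (fun i => f (x i)) N (t + 1)
        - (Scoring.autocov κ π (fun y => f y - ∫ z, f z ∂π) 0
          + 2 * ∑' t, Scoring.autocov κ π (fun y => f y - ∫ z, f z ∂π) (t + 1))) ^ 2
        ∂(Kernel.trajMeasure (X := fun _ : ℕ => S) μ₀
        (fun n : ℕ => κ.comap (fun h : (i : ↥(Finset.Iic n)) → S => h ⟨n, Finset.mem_Iic.2 le_rfl⟩)
          (measurable_pi_apply _)))
      ≤ (3 * (C ^ 4 * (2112 + 4224 * m / ε.toReal + 512 * (m / ε.toReal) ^ 2))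
          + 768 * C ^ 4 * (m / ε.toReal) ^ 2
          + (12 * (C ^ 4 * (2112 + 4224 * m / ε.toReal + 512 * (m / ε.toReal) ^ 2)) + 12288 * C ^ 4)
            * ((m : ℝ) * (Real.log N / (2 * ε.toReal) + 2)) ^ 3) / N := by
  have hεtop : ε ≠ ∞ := ne_top_of_le_ne_top ENNReal.one_ne_top hε1
  have hεpos : 0 < ε.toReal := ENNReal.toReal_pos hε0.ne' hεtop
  have hε1' : ε.toReal ≤ 1 := ENNReal.toReal_le_of_le_ofReal zero_le_one (by simpa using hε1)
  have hN' : (0 : ℝ) < N := by exact_mod_cast hN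
  have hC0 : 0 ≤ C := (abs_nonneg _).trans (hC (Classical.choice (nonempty_of_isProbabilityMeasure μ₀)))
  have htrunc := truncation_le_inv_of_certifiedWindow hεpos hε1' hm hN
  have h := chain_mse_gammaWindow_le_of_truncation_le μ₀ hmin hε0 hε1 hm hπ hf hC hWN hN htrunc
  refine h.trans (div_le_div_of_nonneg_right ?_ hN'.le)
  have hWle := certifiedWindow_le hεpos m hN (e := ε.toReal)
  have hW0 : (0 : ℝ) ≤ ((m * (⌈Real.log N / (2 * ε.toReal)⌉₊ + 1) - 1 : ℕ) : ℝ) := Nat.cast_nonneg _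
  have hcube : (((m * (⌈Real.log N / (2 * ε.toReal)⌉₊ + 1) - 1 : ℕ) : ℝ)) ^ 3
      ≤ ((m : ℝ) * (Real.log N / (2 * ε.toReal) + 2)) ^ 3 := pow_le_pow_left₀ hW0 hWle 3
  have hcoef : 0 ≤ 12 * (C ^ 4 * (2112 + 4224 * m / ε.toReal + 512 * (m / ε.toReal) ^ 2))
      + 12288 * C ^ 4 := by positivity
  nlinarith [mul_le_mul_of_nonneg_left hcube hcoef]

end Chain

end Summit.Ventures.LatticeQCDFlow.Exactness.GeneralNCMC
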